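import Summits.ResolutionOfSingularities.ResolutionOfSingularities.Theorems.FolLU.Negative.SameModelSetup

/-!
# Crux `FolLU` (stmt-ResolutionOfSingularities-17081) — the model MUST change: additive points exist

Route `ResolutionOfSingularities/FoliationDescent`, crux `FolLU` (foliation local uniformization).
`folLU_false_sameModel` proves that the natural STRENGTHENING of the crux in which the dominating
model `S'` is required to be the given model `S` itself (everything else verbatim: a rescaling
`g • D`, `g ≠ 0`, maps `S_c` into itself and is NON-SINGULAR or MULTIPLICATIVE there) is FALSE.

Witness (an ADDITIVE saturated singular point of order two): `p = 2`, `k = 𝔽₂`,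
`K = Frac 𝔽₂[X₀,X₁]`, `S = 𝔽₂[X₀,X₁]`, `O` = the valuation ring of the order-of-vanishing valuation
at the origin (divisorial, centre = the origin on `S`), `D = X₀²∂₀ + X₁²∂₁` (`D ∘ D = 0`), all from
`SameModelSetup.lean`.
* `g • D ↷ S_c` forces `ord g ≥ 0`: `g X₀², g X₁² ∈ S_c` and `X₀` is prime, `X₀ ∤ X₁`,
  `X₀ ∤ b` for `b(0) ≠ 0` (`X0_sq_dvd`);
* `ord (D z) ≥ ord z + 1` on all of `K` (`extension_D_le`);
* hence every value of `g • D` on `S_c` has order `≥ 1` (NON-SINGULAR fails) and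
  `ord ((g•D)^[2] X₀) ≥ 2 ord g + 3 > ord g + 2 = ord (u · (g•D) X₀)` for a unit `u`
  (MULTIPLICATIVE fails).
This certifies the non-vacuity of the additive regime (the inputs of `stub_orderReduction` /
`stub_nilpotentExit` of `Cruxes/FolLU/Lines/birth.lean`): blow-ups are necessary in `FolLU`.
Definition-free, kernel-only. Refuter seat refuter-cdisprove-stmt-ResolutionOfSingularities-17081-0,
2026-08-17.
-/

set_option linter.dupNamespace false

namespace Summit.ResolutionOfSingularities.ResolutionOfSingularities.Theorems

noncomputable section

open MvPolynomial WithZero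

namespace FolLUSameModelNeg

/-- `X₀² ∣ a₁` from `a₁ b₂ X₁² = a₂ b₁ X₀²` with `b₂(0) ≠ 0` (`X₀` prime, `X₀ ∤ X₁`, `X₀ ∤ b₂`).
[folklore] -/
theorem X0_sq_dvd {a₁ b₁ a₂ b₂ : MvPolynomial (Fin 2) (ZMod 2)} (hb₂ : constantCoeff b₂ ≠ 0)
    (h : a₁ * b₂ * X 1 ^ 2 = a₂ * b₁ * X 0 ^ 2) : X 0 ^ 2 ∣ a₁ := by
  have hp : Prime (X 0 : MvPolynomial (Fin 2) (ZMod 2)) := X_prime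
  have hX : ¬ (X 0 : MvPolynomial (Fin 2) (ZMod 2)) ∣ X 1 ^ 2 := fun hd =>
    absurd (X_dvd_X.mp (hp.dvd_of_dvd_pow hd)) (by decide)
  have hb : ¬ (X 0 : MvPolynomial (Fin 2) (ZMod 2)) ∣ b₂ := by
    rintro ⟨q, hq⟩
    apply hb₂
    rw [hq, map_mul, constantCoeff_X, zero_mul]
  have step : ∀ {a r : MvPolynomial (Fin 2) (ZMod 2)}, a * b₂ * X 1 ^ 2 = r * X 0 →
      (X 0 : MvPolynomial (Fin 2) (ZMod 2)) ∣ a := by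
    intro a r har
    have h1 : (X 0 : MvPolynomial (Fin 2) (ZMod 2)) ∣ a * b₂ * X 1 ^ 2 := ⟨r, by rw [har, mul_comm]⟩
    rcases hp.dvd_or_dvd h1 with h2 | h2
    · rcases hp.dvd_or_dvd h2 with h3 | h3
      · exact h3
      · exact absurd h3 hb
    · exact absurd h2 hX
  obtain ⟨c, rfl⟩ := step (r := a₂ * b₁ * X 0) (by rw [h]; ring)
  have h' : c * b₂ * X 1 ^ 2 = a₂ * b₁ * X 0 := by
    have h2 : (X 0 : MvPolynomial (Fin 2) (ZMod 2)) * (c * b₂ * X 1 ^ 2) = X 0 * (a₂ * b₁ * X 0) := by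
      linear_combination h
    exact mul_left_cancel₀ (X_ne_zero (0 : Fin 2)) h2
  obtain ⟨c', rfl⟩ := step (r := a₂ * b₁) h'
  exact ⟨c', by ring⟩

/-- `(X₀²∂₀ + X₁²∂₁) Xᵢ = Xᵢ²`. [folklore] -/
theorem d_X (i : Fin 2) :
    (X 0 ^ 2 * pderiv 0 (X i) + X 1 ^ 2 * pderiv 1 (X i) : MvPolynomial (Fin 2) (ZMod 2)) = X i ^ 2 := by
  fin_cases i
  · simp [pderiv_X_of_ne (show (0 : Fin 2) ≠ 1 by decide)]
  · simp [pderiv_X_of_ne (show (1 : Fin 2) ≠ 0 by decide)]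

/-- The model `S = 𝔽₂[X₀,X₁] ⊆ K` is finitely generated (hypothesis `S.FG`). [folklore] -/
theorem range_fg : (IsScalarTower.toAlgHom (ZMod 2) (MvPolynomial (Fin 2) (ZMod 2))
    (FractionRing (MvPolynomial (Fin 2) (ZMod 2)))).range.FG := by
  rw [← Algebra.map_top]
  exact Subalgebra.FG.map _ Algebra.FiniteType.out

/-- `Frac S = K` (hypothesis `IsFractionRing S K`). [folklore] -/
theorem isFractionRing_range : IsFractionRing
    (IsScalarTower.toAlgHom (ZMod 2) (MvPolynomial (Fin 2) (ZMod 2))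
      (FractionRing (MvPolynomial (Fin 2) (ZMod 2)))).range
    (FractionRing (MvPolynomial (Fin 2) (ZMod 2))) := by
  set S := (IsScalarTower.toAlgHom (ZMod 2) (MvPolynomial (Fin 2) (ZMod 2))
      (FractionRing (MvPolynomial (Fin 2) (ZMod 2)))).range
  haveI : FaithfulSMul S (FractionRing (MvPolynomial (Fin 2) (ZMod 2))) :=
    (faithfulSMul_iff_algebraMap_injective S _).mpr Subtype.val_injective
  refine IsFractionRing.of_field S _ fun z => ?_
  obtain ⟨a, b, hb, rfl⟩ := IsFractionRing.div_surjective (A := MvPolynomial (Fin 2) (ZMod 2)) z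
  exact ⟨⟨_, ⟨a, rfl⟩⟩, ⟨_, ⟨b, rfl⟩⟩, rfl⟩

/-- `S ≅ 𝔽₂[X₀,X₁]` is a regular ring (so `S` is regular at every centre). [folklore] -/
theorem isRegularRing_range : IsRegularRing
    (IsScalarTower.toAlgHom (ZMod 2) (MvPolynomial (Fin 2) (ZMod 2))
      (FractionRing (MvPolynomial (Fin 2) (ZMod 2)))).range :=
  IsRegularRing.of_ringEquiv (AlgEquiv.ofInjective _
    (IsFractionRing.injective (MvPolynomial (Fin 2) (ZMod 2))
      (FractionRing (MvPolynomial (Fin 2) (ZMod 2))))).toRingEquiv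

end FolLUSameModelNeg

open FolLUSameModelNeg in
/-- **`FolLU` with `S' := S` is FALSE: additive points exist, so the model must change.**
The negated statement is the crux `FoliationDescent.FolLU` verbatim except that the conclusion
`∃ S' h' g, S ≤ S' ∧ S'.FG ∧ IsFractionRing S' K ∧ (regular at the centre) ∧ g ≠ 0 ∧ …` is replaced
by `∃ g, g ≠ 0 ∧ …` ON THE GIVEN MODEL `S`. Witness: `p = 2`, `k = 𝔽₂`, `K = Frac 𝔽₂[X₀,X₁]`,
`S = 𝔽₂[X₀,X₁]`, `O = ord_{(X₀,X₁)}`, `D = X₀²∂₀ + X₁²∂₁` — a saturated ADDITIVE singular point of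
order two (`D ∘ D = 0`); see the module docstring for the proof. Moral for provers: the `∃ S'`
(blowing up along `O`) is essential already in dimension two; this is the certified non-vacuity of
the additive regime that `stub_orderReduction` / `stub_nilpotentExit` (line `birth`) must treat.
[folklore] -/
theorem folLU_false_sameModel : ¬ (∀ p : ℕ, p.Prime → ∀ (k K : Type) [Field k] [CharP k p]
    [PerfectField k] [Field K] [Algebra k K] (O : ValuationSubring K) (S : Subalgebra k K)
    (hS : S.toSubring ≤ O.toSubring) (D : Derivation k K K), S.FG → IsFractionRing S K →
    IsRegularLocalRing (Localization.AtPrime (Ideal.comap (Subring.inclusion hS)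
      (IsLocalRing.maximalIdeal O))) → D ≠ 0 → (∃ c : K, ∀ x : K, (⇑D)^[p] x = c * D x) →
    ∃ g : K, g ≠ 0 ∧
      (∀ x : K, (∃ a b : K, a ∈ S ∧ b ∈ S ∧ b ≠ 0 ∧ b⁻¹ ∈ O ∧ x = a / b) →
        ∃ a b : K, a ∈ S ∧ b ∈ S ∧ b ≠ 0 ∧ b⁻¹ ∈ O ∧ (g • D) x = a / b) ∧
      ((∃ x : K, (∃ a b : K, a ∈ S ∧ b ∈ S ∧ b ≠ 0 ∧ b⁻¹ ∈ O ∧ x = a / b) ∧ (g • D) x ≠ 0 ∧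
          ((g • D) x)⁻¹ ∈ O) ∨
        (∃ u : K, (∃ a b : K, a ∈ S ∧ b ∈ S ∧ b ≠ 0 ∧ b⁻¹ ∈ O ∧ u = a / b) ∧ u ≠ 0 ∧ u⁻¹ ∈ O ∧
          ∀ x : K, (⇑(g • D))^[p] x = u * (g • D) x))) := by
  intro h
  -- the witness
  obtain ⟨v₀, hv⟩ := exists_ordVal
  obtain ⟨v, hvK⟩ := exists_extension v₀ hv
  obtain ⟨D, hD, hDD⟩ := exists_D
  set A := MvPolynomial (Fin 2) (ZMod 2) with hA
  set K := FractionRing (MvPolynomial (Fin 2) (ZMod 2)) with hK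
  set O : ValuationSubring K := v.valuationSubring with hO
  set S : Subalgebra (ZMod 2) K := (IsScalarTower.toAlgHom (ZMod 2) A K).range with hSdef
  have mem_O : ∀ {z : K}, z ∈ O ↔ v z ≤ 1 := Valuation.mem_valuationSubring_iff _ _
  have mem_S : ∀ {z : K}, z ∈ S ↔ ∃ a : A, algebraMap A K a = z := AlgHom.mem_range _
  have algebraMap_mem_S : ∀ a : A, algebraMap A K a ∈ S := fun a => mem_S.mpr ⟨a, rfl⟩
  have vS : ∀ {z : K}, z ∈ S → v z ≤ 1 := by
    intro z hz
    obtain ⟨a, rfl⟩ := mem_S.mp hz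
    rw [hvK]
    exact ordVal_le_one v₀ hv a
  have hS : S.toSubring ≤ O.toSubring := by
    intro z hz
    change z ∈ O
    rw [mem_O]
    exact vS hz
  have hreg : IsRegularLocalRing (Localization.AtPrime (Ideal.comap (Subring.inclusion hS)
      (IsLocalRing.maximalIdeal O))) := by
    haveI : IsRegularRing S.toSubring := isRegularRing_range
    infer_instance
  have hDX : ∀ i : Fin 2, D (algebraMap A K (X i)) = algebraMap A K (X i ^ 2) := fun i => by
    rw [hD, d_X]
  have hXK : ∀ i : Fin 2, algebraMap A K (X i ^ 2) ≠ 0 := fun i h0 =>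
    pow_ne_zero 2 (X_ne_zero i) ((IsFractionRing.injective A K) (by rw [map_zero]; exact h0))
  have hDne : D ≠ 0 := by
    intro h0
    have := hDX 0
    rw [h0, Derivation.zero_apply] at this
    exact hXK 0 this.symm
  have hpc : ∃ c : K, ∀ x : K, (⇑D)^[2] x = c * D x := ⟨0, fun x => by rw [zero_mul]; exact hDD x⟩
  obtain ⟨g, hg, hpres, hterm⟩ :=
    h 2 Nat.prime_two (ZMod 2) K O S hS D range_fg isFractionRing_range hreg hDne hpc
  -- valuation bookkeeping
  have smulD : ∀ x : K, (g • D) x = g * D x := fun x => by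
    rw [Derivation.smul_apply, smul_eq_mul]
  have one_le_of_inv_mem : ∀ {w : K}, w ≠ 0 → w⁻¹ ∈ O → 1 ≤ v w := by
    intro w hw hwi
    rw [mem_O, map_inv₀] at hwi
    exact (inv_le_one₀ (zero_lt_iff.mpr ((Valuation.ne_zero_iff _).mpr hw))).mp hwi
  have v_eq_one : ∀ {b : K}, b ∈ S → b ≠ 0 → b⁻¹ ∈ O → v b = 1 :=
    fun hbS hb hbi => le_antisymm (vS hbS) (one_le_of_inv_mem hb hbi)
  have v_inCtr : ∀ {x : K}, (∃ a b : K, a ∈ S ∧ b ∈ S ∧ b ≠ 0 ∧ b⁻¹ ∈ O ∧ x = a / b) →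
      v x ≤ 1 := by
    rintro x ⟨a, b, ha, hb, hb0, hbi, rfl⟩
    rw [map_div₀, v_eq_one hb hb0 hbi, div_one]
    exact vS ha
  have hXin : ∀ i : Fin 2, ∃ a b : K, a ∈ S ∧ b ∈ S ∧ b ≠ 0 ∧ b⁻¹ ∈ O ∧
      algebraMap A K (X i) = a / b := fun i =>
    ⟨algebraMap A K (X i), 1, algebraMap_mem_S _, Subalgebra.one_mem _, one_ne_zero,
      by rw [inv_one]; exact O.one_mem, by rw [div_one]⟩
  have hgrowth := extension_D_le v₀ hv v hvK D hD
  -- Step 1: `v g ≤ 1` (`g ∈ S_c` in fact), from `g X₀², g X₁² ∈ S_c` and unique factorisation.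
  have hvg : v g ≤ 1 := by
    obtain ⟨a₁, b₁, ha₁, hb₁, hb₁0, hb₁i, h₁⟩ := hpres _ (hXin 0)
    obtain ⟨a₂, b₂, ha₂, hb₂, hb₂0, hb₂i, h₂⟩ := hpres _ (hXin 1)
    rw [smulD, hDX] at h₁ h₂
    have hvb₁ : v b₁ = 1 := v_eq_one hb₁ hb₁0 hb₁i
    have hvb₂ : v b₂ = 1 := v_eq_one hb₂ hb₂0 hb₂i
    obtain ⟨a₁, rfl⟩ := mem_S.mp ha₁
    obtain ⟨b₁, rfl⟩ := mem_S.mp hb₁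
    obtain ⟨a₂, rfl⟩ := mem_S.mp ha₂
    obtain ⟨b₂, rfl⟩ := mem_S.mp hb₂
    have hb₂A : b₂ ≠ 0 := fun h0 => hb₂0 (by rw [h0, map_zero])
    have hcb₂ : constantCoeff b₂ ≠ 0 := (ordVal_eq_one_iff v₀ hv hb₂A).mp (by rw [← hvK]; exact hvb₂)
    -- the polynomial identity `a₁ b₂ X₁² = a₂ b₁ X₀²`
    have hidK : algebraMap A K (a₁ * b₂ * X 1 ^ 2) = algebraMap A K (a₂ * b₁ * X 0 ^ 2) := by
      simp only [map_mul]
      have e1 : algebraMap A K a₁ = g * algebraMap A K (X 0 ^ 2) * algebraMap A K b₁ := by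
        rw [h₁, div_mul_cancel₀ _ hb₁0]
      have e2 : algebraMap A K a₂ = g * algebraMap A K (X 1 ^ 2) * algebraMap A K b₂ := by
        rw [h₂, div_mul_cancel₀ _ hb₂0]
      rw [e1, e2]; ring
    have hid : a₁ * b₂ * X 1 ^ 2 = a₂ * b₁ * X 0 ^ 2 := (IsFractionRing.injective A K) hidK
    obtain ⟨c, rfl⟩ := X0_sq_dvd hcb₂ hid
    -- `g = c / b₁`
    have hgc : g = algebraMap A K c / algebraMap A K b₁ := by
      rw [eq_div_iff hb₁0]
      have := congrArg (· * algebraMap A K b₁) h₁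
      simp only [div_mul_cancel₀ _ hb₁0, map_mul] at this
      have h3 : algebraMap A K (X 0 ^ 2) * (g * algebraMap A K b₁) =
          algebraMap A K (X 0 ^ 2) * algebraMap A K c := by
        rw [← this]; ring
      exact mul_left_cancel₀ (hXK 0) h3
    rw [hgc, map_div₀, hvb₁, div_one]
    exact vS (algebraMap_mem_S c)
  have hg0 : v g ≠ 0 := (Valuation.ne_zero_iff _).mpr hg
  have hgexp : v g = exp (log (v g)) := (exp_log hg0).symm
  have hm : log (v g) ≤ 0 := by
    have := hvg
    rw [hgexp, ← exp_zero, exp_le_exp] at this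
    exact this
  rcases hterm with ⟨x, hx, hDx, hinv⟩ | ⟨u, hu, hu0, hui, hmult⟩
  · -- NON-SINGULAR is impossible: every value of `g • D` on `S_c` has order ≥ 1
    have h1 : 1 ≤ v ((g • D) x) := one_le_of_inv_mem hDx hinv
    have h2 : v ((g • D) x) ≤ exp (-1) := by
      rw [smulD, map_mul]
      calc v g * v (D x) ≤ 1 * (exp (-1) * v x) := mul_le_mul' hvg (hgrowth x)
        _ ≤ 1 * (exp (-1) * 1) := mul_le_mul' le_rfl (mul_le_mul' le_rfl (v_inCtr hx))
        _ = exp (-1) := by rw [one_mul, mul_one]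
    have := h1.trans h2
    rw [← exp_zero, exp_le_exp] at this
    omega
  · -- MULTIPLICATIVE is impossible: compare orders in `(g•D)^[2] X₀ = u · (g•D) X₀`
    have hvu : v u = 1 := le_antisymm (v_inCtr hu) (one_le_of_inv_mem hu0 hui)
    have key := hmult (algebraMap A K (X 0))
    have lhs : (⇑(g • D))^[2] (algebraMap A K (X 0)) = g * D (g * algebraMap A K (X 0 ^ 2)) := by
      show (g • D) ((g • D) _) = _
      rw [smulD, smulD, hDX]
    rw [lhs, smulD, hDX] at key
    -- key : g * D (g * X0²) = u * (g * X0²)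
    have hs : v (algebraMap A K (X 0 ^ 2)) = exp (-2) := by
      rw [hvK, map_pow, ordVal_X v₀ hv, ← exp_nsmul]; norm_num
    have hrhs : v (u * (g * algebraMap A K (X 0 ^ 2))) = exp (log (v g) - 2) := by
      rw [map_mul, map_mul, hvu, one_mul, hs, hgexp, log_exp, ← exp_add]; ring_nf
    by_cases hD0 : D (g * algebraMap A K (X 0 ^ 2)) = 0
    · rw [hD0, mul_zero] at key
      exact mul_ne_zero hu0 (mul_ne_zero hg (hXK 0)) key.symm
    have hD0' : v (D (g * algebraMap A K (X 0 ^ 2))) ≠ 0 := (Valuation.ne_zero_iff _).mpr hD0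
    set n := log (v (D (g * algebraMap A K (X 0 ^ 2)))) with hn
    have hnexp : v (D (g * algebraMap A K (X 0 ^ 2))) = exp n := (exp_log hD0').symm
    have hgrow := hgrowth (g * algebraMap A K (X 0 ^ 2))
    rw [hnexp, map_mul, hs, hgexp, ← exp_add, ← exp_add, exp_le_exp] at hgrow
    have hlhs : v (g * D (g * algebraMap A K (X 0 ^ 2))) = exp (log (v g) + n) := by
      rw [map_mul, hnexp, hgexp, log_exp, exp_add]
    have := congrArg v key
    rw [hlhs, hrhs, exp_inj] at this
    omega

end

end Summit.ResolutionOfSingularities.ResolutionOfSingularities.Theorems
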